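import Summits.BirchSwinnertonDyer.Rank1Residual.X11b.LocalKernelCoinvariantsExact
import Summits.BirchSwinnertonDyer.Rank1Residual.X11b.BDPRouteLocalKernelAlgebra
import HarnessLib

/-!
# X11b, route R1 — the LOWER bound in Greenberg's Lemma 3.3 at a bad place: `#ker r_v ≥
# [B_v^{γ_v} : B_v^{γ_v} ⊓ B₀]` for every `γ_v`-stable finite-index `B₀ ≤ B_v` (Step 1c of atom (P11))

HONEST FRAMING (cell `b2b-bsdres`, run/shared/lean/b2b/bsd-rank1-residual/, verbatim in every
file): the goal of the cell is to DELETE the COMBINATION-SHAPED residual classes of the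
Birch–Swinnerton-Dyer formula for ALL analytic-rank `≤ 1` elliptic curves over `ℚ` — "full BSD
formula for every rank `≤ 1` curve in class `C`" assembled STRICTLY from published theorems — so
that the rank-`≤ 1` remainder becomes exactly the CONSTRUCTION-SHAPED classes, which are TYPED
(missing-input `Prop`s), NOT attempted. This is not "finishing BSD". Sub-cell
`b2b-bsdres-multr1-p1` (X11b, route R1 = Castella 2018 Thm. A re-proved along the author's
erratum); a RESEARCH ROUTE; no claim beyond the stated class; X11b stays CONSTRUCTION-SHAPED;
nothing here changes a label; no named fact is minted (theorems only; no definition; no `sorry`).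

## What this file proves

Route p2's `TamagawaCoinvariants.natCard_quotient_range_le_pow_padicValNat_relIndex` is the UPPER
half of the algebra of Greenberg's Lemma 3.3 at a bad `v ∤ p` (`#B/φ(B) ≤ p^{ord_p [ker φ : ker φ ⊓ M₀]}`).
This file gives the LOWER half, in the form the exact count needs:

* `TamagawaCoinvariants.relIndex_ker_le_natCard_quotient_range` — pure algebra: for an endomorphism
  `ψ` of an abelian group `B` and a `ψ`-stable subgroup `B₀` with `B/B₀` finite and `B/ψ(B)` finite,
  `[ker ψ : ker ψ ⊓ B₀] ≤ #(B/ψ(B))` (`B/ψ(B) ↠ C/ψ̄(C)` for `C = B/B₀`; `#(C/ψ̄(C)) = #ker ψ̄`;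
  `ker ψ̄ ⊇` the image of `ker ψ`, of order `[ker ψ : ker ψ ⊓ B₀]`).
* **`AcSelmer.relIndex_ker_decompSubOne_le_natCard_localKer`** — on the constructed objects: for a
  `ℤ_p`-extension `κ`, a discrete `p`-primary `Γ_K`-module `M` with continuous orbit maps, a finite
  place `v` NOT split completely in `K_∞` (`¬ D_v ≤ ker κ`), a topological generator `g` of `D_v`
  modulo `D_v ⊓ ker κ`, and any `(g − 1)`-stable `B₀ ≤ B_v = M^{ker κ ⊓ D_v}` with `B_v/B₀` finite:
  if `ker r_v` is finite then `[B_v^{g} : B_v^{g} ⊓ B₀] ≤ #ker r_v` — because `#ker r_v =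
  #(B_v/(g − 1)B_v)` EXACTLY (`natCard_localKer_eq_natCard_quotient_range_decompSubOne`, gen 18, from
  gen 17's procyclic engine), which also makes `B_v/(g − 1)B_v` finite.

Intended `B₀ = ` the points of `B_v = E(K_{∞,η})[p^∞]` with non-singular reduction, `B_v^{g} =
E(K_v)[p^∞]`, `[E(K_v)[p^∞] : E₀-part] = #Φ_v(k_v)[p^∞] = c_v^{(p)}` (next file): with route p2's upper
bound this is Greenberg's "`ker r_v` has order exactly `c_v^{(p)}`" (LNM 1716 p. 74) at the places
`w ∣ N⁺` finitely decomposed in `K_∞^{ac}`.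

References: [GreenbergLNM1716] §3 Lemma 3.3 (p. 87), §4 proof of Thm. 4.1 (pp. 74–75);
[JetchevSkinnerWan2017] Prop. 3.3.4 Case 1(a) (arXiv:1512.06894 pp. 12–13).
-/

noncomputable section

open scoped Classical

open NumberField IsDedekindDomain Field Function
open Literature.NumberTheory.EllipticCurves Literature.NumberTheory.EllipticCurves.GreenbergSelmer
open Literature.NumberTheory.GaloisRepresentations

universe u

/-! ## 1. Algebra: `[ker ψ : ker ψ ⊓ B₀] ≤ #(B/ψ(B))` -/

namespace Summit.BirchSwinnertonDyer.Rank1Residual.X11b.TamagawaCoinvariants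

/-- **The lower half of the algebra of Greenberg's Lemma 3.3.** For an endomorphism `ψ` of an
abelian group `B` and a `ψ`-stable subgroup `B₀ ≤ B` with `B/B₀` finite and `B/ψ(B)` finite:
`[ker ψ : ker ψ ⊓ B₀] ≤ #(B/ψ(B))`. Indeed `B/ψ(B)` maps ONTO `C/ψ̄(C)`, `C = B/B₀` with the induced
`ψ̄`; `#(C/ψ̄(C)) = #ker ψ̄` (`C` finite); and `ker ψ̄` contains the image of `ker ψ` in `C`, a group
of order `[ker ψ : ker ψ ⊓ B₀]`. [cite: GreenbergLNM1716, §3 Lemma 3.3 (p. 87) and §4 proof of Thm. 4.1 (p. 74)] -/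
theorem relIndex_ker_le_natCard_quotient_range {B : Type*} [AddCommGroup B] (ψ : B →+ B)
    (B₀ : AddSubgroup B) (hst : ∀ b ∈ B₀, ψ b ∈ B₀) [Finite (B ⧸ B₀)] [Finite (B ⧸ ψ.range)] :
    B₀.relIndex ψ.ker ≤ Nat.card (B ⧸ ψ.range) := by
  classical
  -- the induced endomorphism `ψ̄` of `C = B/B₀`
  have hB₀stab : B₀ ≤ B₀.comap ψ := fun b hb ↦ by
    rw [AddSubgroup.mem_comap]; exact hst b hb
  set ψbar : B ⧸ B₀ →+ B ⧸ B₀ := QuotientAddGroup.map B₀ B₀ ψ hB₀stab with hψbar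
  have hψbar_mk : ∀ b : B, ψbar (b : B ⧸ B₀) = ((ψ b : B) : B ⧸ B₀) :=
    fun b ↦ QuotientAddGroup.map_mk B₀ B₀ ψ hB₀stab b
  -- `B/ψ(B) ↠ C/ψ̄(C)`
  have hrange : ψ.range ≤ (ψbar.range.comap (QuotientAddGroup.mk' B₀)) := by
    rintro _ ⟨b, rfl⟩
    rw [AddSubgroup.mem_comap, QuotientAddGroup.mk'_apply]
    exact ⟨(b : B ⧸ B₀), hψbar_mk b⟩
  set π : B ⧸ ψ.range →+ (B ⧸ B₀) ⧸ ψbar.range :=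
    QuotientAddGroup.map ψ.range ψbar.range (QuotientAddGroup.mk' B₀) hrange with hπ
  have hπsurj : Surjective π := by
    intro q
    induction q using QuotientAddGroup.induction_on with
    | H c =>
      induction c using QuotientAddGroup.induction_on with
      | H b =>
        refine ⟨(b : B ⧸ ψ.range), ?_⟩
        rw [hπ, QuotientAddGroup.map_mk]
        rfl
  -- the image of `ker ψ` in `C` lies in `ker ψ̄`
  let ρ : ψ.ker →+ B ⧸ B₀ := (QuotientAddGroup.mk' B₀).comp ψ.ker.subtype
  have hρ_le : ρ.range ≤ ψbar.ker := by
    rintro _ ⟨x, rfl⟩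
    rw [AddMonoidHom.mem_ker, AddMonoidHom.comp_apply, QuotientAddGroup.mk'_apply,
      AddSubgroup.coe_subtype, hψbar_mk, (AddMonoidHom.mem_ker).mp x.2, QuotientAddGroup.mk_zero]
  -- `#ρ.range = [ker ψ : ker ψ ⊓ B₀]`
  have hρker : ρ.ker = B₀.addSubgroupOf ψ.ker := by
    ext x
    rw [AddMonoidHom.mem_ker, AddMonoidHom.comp_apply, QuotientAddGroup.mk'_apply,
      QuotientAddGroup.eq_zero_iff, AddSubgroup.mem_addSubgroupOf]
    rfl
  have hρcard : Nat.card ρ.range = B₀.relIndex ψ.ker := by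
    rw [AddSubgroup.relIndex, ← hρker, AddSubgroup.index_ker]
  haveI : Finite ((B ⧸ B₀) ⧸ ψbar.range) := inferInstance
  -- assemble
  calc B₀.relIndex ψ.ker = Nat.card ρ.range := hρcard.symm
    _ ≤ Nat.card ψbar.ker := AddSubgroup.card_le_of_le hρ_le
    _ = Nat.card ((B ⧸ B₀) ⧸ ψbar.range) := (natCard_quotient_range_eq_natCard_ker ψbar).symm
    _ ≤ Nat.card (B ⧸ ψ.range) := Nat.card_le_card_of_surjective π hπsurj

end Summit.BirchSwinnertonDyer.Rank1Residual.X11b.TamagawaCoinvariants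

/-! ## 2. On the constructed objects: `[B_v^{γ_v} : B_v^{γ_v} ⊓ B₀] ≤ #ker r_v` -/

namespace Summit.BirchSwinnertonDyer.Rank1Residual.X11b.AcSelmer

variable {K : Type u} [Field K] [NumberField K] {p : ℕ} [Fact p.Prime] (κ : ZpExtension K p)
variable (M : Type u) [AddCommGroup M] [DistribMulAction (absoluteGaloisGroup K) M]
  [TopologicalSpace M] [DiscreteTopology M]

/-- **`B_v/(γ_v − 1)B_v` is finite as soon as `ker r_v` is**, at a place finitely decomposed in
`K_∞` (the orders agree: `natCard_localKer_eq_natCard_quotient_range_decompSubOne`).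
[cite: GreenbergLNM1716, §3 Lemma 3.3 (proof, p. 87)] -/
theorem finite_quotient_range_decompSubOne_of_finite_localKer
    (hcont : ∀ m : M, Continuous fun σ : absoluteGaloisGroup K ↦ σ • m) (hM : IsPrimaryTorsion p M)
    {v : HeightOneSpectrum (𝓞 K)} (hv : ¬ decomp v ≤ κ.kerSubgroup)
    {g : ↥((⊤ : Subgroup (absoluteGaloisGroup K)) ⊓ decomp v)}
    (hgen : ∀ U : Subgroup ↥((⊤ : Subgroup (absoluteGaloisGroup K)) ⊓ decomp v),
      IsOpen (U : Set ↥((⊤ : Subgroup (absoluteGaloisGroup K)) ⊓ decomp v)) →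
        κ.kerSubgroup.subgroupOf ((⊤ : Subgroup (absoluteGaloisGroup K)) ⊓ decomp v) ≤ U →
          g ∈ U → U = ⊤)
    [Finite (localKer κ.kerSubgroup M v)] :
    Finite (FixedPoints.addSubgroup ↥(κ.kerSubgroup ⊓ decomp v) M ⧸
      (decompSubOne κ M (g : absoluteGaloisGroup K) (Subgroup.mem_inf.mp g.2).2).range) := by
  haveI : Nonempty (localKer κ.kerSubgroup M v) := ⟨0⟩
  refine Nat.finite_of_card_ne_zero ?_
  rw [← natCard_localKer_eq_natCard_quotient_range_decompSubOne κ M hcont hM hv hgen]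
  exact Nat.card_pos.ne'

/-- **The lower bound of Greenberg's Lemma 3.3 on the constructed objects.** For a `ℤ_p`-extension
`κ` of a number field `K`, a discrete `p`-primary `Γ_K`-module `M` with continuous orbit maps, a
finite place `v` NOT split completely in `K_∞/K` (`¬ D_v ≤ ker κ`), `g ∈ D_v` generating `D_v`
topologically modulo `D_v ⊓ ker κ`, and a `(g − 1)`-stable subgroup `B₀ ≤ B_v = M^{ker κ ⊓ D_v}`
with `B_v/B₀` finite: if `ker r_v = ker (H¹(D_v, M) → H¹(D_v ⊓ ker κ, M))` is finite, then
`[ker(g − 1) : ker(g − 1) ⊓ B₀] ≤ #ker r_v` (`ker(g − 1) = B_v^{g} = M^{D_v}`). With route p2's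
upper bound and `[E(K_v)[p^∞] : E₀-part] = c_v^{(p)}` this pins `#ker r_v = c_v^{(p)}`.
[cite: GreenbergLNM1716, §3 Lemma 3.3 (p. 87) and §4 proof of Thm. 4.1 (p. 74)]
[cite: JetchevSkinnerWan2017, Prop. 3.3.4 Case 1(a) (arXiv:1512.06894 pp. 12–13)] -/
theorem relIndex_ker_decompSubOne_le_natCard_localKer
    (hcont : ∀ m : M, Continuous fun σ : absoluteGaloisGroup K ↦ σ • m) (hM : IsPrimaryTorsion p M)
    {v : HeightOneSpectrum (𝓞 K)} (hv : ¬ decomp v ≤ κ.kerSubgroup)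
    {g : ↥((⊤ : Subgroup (absoluteGaloisGroup K)) ⊓ decomp v)}
    (hgen : ∀ U : Subgroup ↥((⊤ : Subgroup (absoluteGaloisGroup K)) ⊓ decomp v),
      IsOpen (U : Set ↥((⊤ : Subgroup (absoluteGaloisGroup K)) ⊓ decomp v)) →
        κ.kerSubgroup.subgroupOf ((⊤ : Subgroup (absoluteGaloisGroup K)) ⊓ decomp v) ≤ U →
          g ∈ U → U = ⊤)
    (B₀ : AddSubgroup (FixedPoints.addSubgroup ↥(κ.kerSubgroup ⊓ decomp v) M))
    (hst : ∀ b ∈ B₀, decompSubOne κ M (g : absoluteGaloisGroup K) (Subgroup.mem_inf.mp g.2).2 b ∈ B₀)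
    [Finite (FixedPoints.addSubgroup ↥(κ.kerSubgroup ⊓ decomp v) M ⧸ B₀)]
    [Finite (localKer κ.kerSubgroup M v)] :
    B₀.relIndex (decompSubOne κ M (g : absoluteGaloisGroup K) (Subgroup.mem_inf.mp g.2).2).ker ≤
      Nat.card (localKer κ.kerSubgroup M v) := by
  haveI := finite_quotient_range_decompSubOne_of_finite_localKer κ M hcont hM hv hgen
  rw [natCard_localKer_eq_natCard_quotient_range_decompSubOne κ M hcont hM hv hgen]
  exact TamagawaCoinvariants.relIndex_ker_le_natCard_quotient_range _ B₀ hst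

end Summit.BirchSwinnertonDyer.Rank1Residual.X11b.AcSelmer

end
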